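import Summits.AtomisticToContinuum.Crystallization.Theorems.ShellsToBarlowChart.Negative.Calibration
import Literature.Geometry.DiscreteGeometry.KissingRigidity
import Mathlib.Analysis.Normed.Affine.MazurUlam
import Mathlib.Analysis.Normed.Module.FiniteDimension

/-!
# Rigidity of contact automorphisms of the ideal Barlow stackings

Helper file A of stub `stub_powerTranslation` (line `develop-the-model-growth-descent`, crux
`ShellsToBarlowChart`, stmt-AtomisticToContinuum-9227): a bijection of the model
`B = barlowStacking 1 √(2/3) s` onto itself preserving and reflecting contacts (unit distances)
is the restriction of an isometry of `ℝ³` (`contactAut_eq_isometry`).  Star by star: the twelve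
contacts of a site `u` are `u + ½ A (ref i)` for the FCC or HCP reference configuration
(`hasFccOrHcpShells_barlowStacking'`, rescaled); their images, recentred at `σ u` and doubled,
realize the FCC/HCP contact pattern (distance gap `(1, √2)`), so by `fcc_rigid` / `hcp_rigid`
(Hales 2012, Lemma 10) `σ` agrees on the closed star with an isometry; adjacent closed stars
share a regular unit tetrahedron, on which an isometry is determined; the contact graph is
connected.
-/

noncomputable section

namespace Summit.AtomisticToContinuum.Crystallization.Theorems.PalmUnimodularRigidityShellsToBarlowChart

open Literature.Geometry.DiscreteGeometry Literature.MathematicalPhysics.StatisticalMechanics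
open Summit.AtomisticToContinuum.Crystallization.Theorems.ShellsToBarlowChartNegative
open RealInnerProductSpace

/-- Euclidean `3`-space. -/
local notation "E3" => EuclideanSpace ℝ (Fin 3)

/-! ## The frame of a star -/

/-- Rescaling between the model (scale `1`) and Hales's stacking (scale `2`). [folklore] -/
theorem pt_two_smul_mem_iff {s : ℤ → ℤ} {u : E3} :
    (2 : ℝ) • u ∈ barlowStacking 2 (2 * Real.sqrt (2 / 3)) s ↔
      u ∈ barlowStacking 1 (Real.sqrt (2 / 3)) s := by
  have h := smul_mem_barlowStacking_iff (t := 2) (a := 1) (h := Real.sqrt (2 / 3)) two_ne_zero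
    (s := s) (x := u)
  rwa [mul_one] at h

/-- **The contacts of a site in a frame.** If the kissing shell of `2u` in Hales's stacking is the
image of the pattern `P` under the linear isometry `A`, and `2P` is enumerated by
`i ↦ refPt N (tab i)`, then the points `u + ½ A (refPt N (tab i))` are sites of the model and every
contact of `u` is one of them. [folklore] -/
theorem pt_frame_of_shell {s : ℤ → ℤ} {u : E3} {N : ℕ} {tab : Fin 12 → Fin 3 → ℤ} {P : Finset E3}
    (hP : (fun p => (2 : ℝ) • p) '' (P : Set E3) = Set.range fun i => refPt N (tab i))
    (A : E3 →ₗᵢ[ℝ] E3)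
    (hA : kissingShell (barlowStacking 2 (2 * Real.sqrt (2 / 3)) s) ((2 : ℝ) • u) =
      (fun p => (2 : ℝ) • A p) '' (P : Set E3)) :
    (∀ i, u + (1 / 2 : ℝ) • A (refPt N (tab i)) ∈ barlowStacking 1 (Real.sqrt (2 / 3)) s) ∧
    (∀ q ∈ barlowStacking 1 (Real.sqrt (2 / 3)) s, dist u q = 1 →
      ∃ i, q = u + (1 / 2 : ℝ) • A (refPt N (tab i))) := by
  have hrange : kissingShell (barlowStacking 2 (2 * Real.sqrt (2 / 3)) s) ((2 : ℝ) • u) =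
      Set.range fun i => A (refPt N (tab i)) := by
    rw [hA]
    have : (fun p => (2 : ℝ) • A p) '' (P : Set E3) =
        A '' ((fun p => (2 : ℝ) • p) '' (P : Set E3)) := by
      rw [Set.image_image]; simp only [map_smul]
    rw [this, hP, ← Set.range_comp]
    rfl
  constructor
  · intro i
    have hi : A (refPt N (tab i)) ∈
        kissingShell (barlowStacking 2 (2 * Real.sqrt (2 / 3)) s) ((2 : ℝ) • u) := by
      rw [hrange]; exact Set.mem_range_self i
    obtain ⟨hmem, -⟩ := hi
    have : (2 : ℝ) • (u + (1 / 2 : ℝ) • A (refPt N (tab i))) = (2 : ℝ) • u + A (refPt N (tab i)) := by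
      rw [smul_add, smul_smul]; norm_num
    rw [← pt_two_smul_mem_iff, this]
    exact hmem
  · intro q hq hd
    have hx : (2 : ℝ) • (q - u) ∈
        kissingShell (barlowStacking 2 (2 * Real.sqrt (2 / 3)) s) ((2 : ℝ) • u) := by
      refine ⟨?_, ?_⟩
      · rw [← smul_add, add_sub_cancel]; exact pt_two_smul_mem_iff.2 hq
      · rw [norm_smul, Real.norm_two, ← dist_eq_norm, dist_comm, hd, mul_one]
    rw [hrange] at hx
    obtain ⟨i, hi⟩ := hx
    refine ⟨i, ?_⟩
    have hi' : A (refPt N (tab i)) = (2 : ℝ) • (q - u) := hi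
    rw [hi', smul_smul, show (1 / 2 : ℝ) * 2 = 1 by norm_num, one_smul, add_sub_cancel]

/-- **Every star of the model has an FCC or an HCP frame.** [cite: HalesDSP2012, §1.3] -/
theorem pt_exists_frame {s : ℤ → ℤ} (hs : IsHaggSeq s) {u : E3}
    (hu : u ∈ barlowStacking 1 (Real.sqrt (2 / 3)) s) :
    ∃ A : E3 →ₗᵢ[ℝ] E3,
      ((∀ i, u + (1 / 2 : ℝ) • A (fccRef i) ∈ barlowStacking 1 (Real.sqrt (2 / 3)) s) ∧
        (∀ q ∈ barlowStacking 1 (Real.sqrt (2 / 3)) s, dist u q = 1 →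
          ∃ i, q = u + (1 / 2 : ℝ) • A (fccRef i))) ∨
      ((∀ i, u + (1 / 2 : ℝ) • A (hcpRef i) ∈ barlowStacking 1 (Real.sqrt (2 / 3)) s) ∧
        (∀ q ∈ barlowStacking 1 (Real.sqrt (2 / 3)) s, dist u q = 1 →
          ∃ i, q = u + (1 / 2 : ℝ) • A (hcpRef i))) := by
  rcases hasFccOrHcpShells_barlowStacking' hs _ (pt_two_smul_mem_iff.2 hu) with ⟨A, hA⟩ | ⟨A, hA⟩
  · exact ⟨A, Or.inl (pt_frame_of_shell two_smul_image_fcc_eq_range A hA)⟩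
  · exact ⟨A, Or.inr (pt_frame_of_shell two_smul_image_hcp_eq_range A hA)⟩


/-! ## Local rigidity of a star -/

/-- **Local rigidity (generic in the pattern).** Let `σ` be a bijection of the model onto itself
preserving and reflecting contacts, and let the star of `u` be framed by `A` in the enumerated
pattern `tab` (squared norms `N`, contact relation `|tab i − tab j|² = N`) which is rigid on
`S²(2)` and in which every vertex lies in a contact triangle.  Then `σ` agrees on the closed star
of `u` with an isometry of `ℝ³`, and every edge `u q` of the star lies in a regular unit
tetrahedron `u q r r'` of sites. [cite: Hales2012, Lemma 10] -/
theorem pt_local_rigidity {s : ℤ → ℤ} {σ : E3 → E3} (hs : IsHaggSeq s)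
    (hbij : Set.BijOn σ (barlowStacking 1 (Real.sqrt (2 / 3)) s) (barlowStacking 1 (Real.sqrt (2 / 3)) s))
    (hcontact : ∀ q ∈ barlowStacking 1 (Real.sqrt (2 / 3)) s, ∀ q' ∈ barlowStacking 1 (Real.sqrt (2 / 3)) s,
      (dist (σ q) (σ q') = 1 ↔ dist q q' = 1))
    {N : ℕ} (hN : N ≠ 0) {tab : Fin 12 → Fin 3 → ℤ} (htab : Function.Injective tab)
    (hnorm : ∀ i, sqNormInt (tab i) = N)
    (rigid : ∀ {σ' : ℝ} {x : Fin 12 → E3},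
      IsRealization (fun i j => sqNormInt (tab i - tab j) = N) σ' x →
        ∃ L : E3 →ₗᵢ[ℝ] E3, ∀ i, L (refPt N (tab i)) = x i)
    (htri : ∀ i, ∃ j k, sqNormInt (tab i - tab j) = N ∧ sqNormInt (tab i - tab k) = N ∧
      sqNormInt (tab j - tab k) = N)
    {u : E3} (hu : u ∈ barlowStacking 1 (Real.sqrt (2 / 3)) s) (A : E3 →ₗᵢ[ℝ] E3)
    (hmem : ∀ i, u + (1 / 2 : ℝ) • A (refPt N (tab i)) ∈ barlowStacking 1 (Real.sqrt (2 / 3)) s)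
    (hsurj : ∀ q ∈ barlowStacking 1 (Real.sqrt (2 / 3)) s, dist u q = 1 →
      ∃ i, q = u + (1 / 2 : ℝ) • A (refPt N (tab i))) :
    (∃ g : E3 ≃ᵢ E3, g u = σ u ∧
      ∀ q ∈ barlowStacking 1 (Real.sqrt (2 / 3)) s, dist u q = 1 → g q = σ q) ∧
    (∀ q ∈ barlowStacking 1 (Real.sqrt (2 / 3)) s, dist u q = 1 →
      ∃ r ∈ barlowStacking 1 (Real.sqrt (2 / 3)) s, ∃ r' ∈ barlowStacking 1 (Real.sqrt (2 / 3)) s,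
        dist u r = 1 ∧ dist u r' = 1 ∧ dist q r = 1 ∧ dist q r' = 1 ∧ dist r r' = 1) := by
  have hsq : Real.sqrt (2 / 3) ^ 2 = 2 / 3 * (1 : ℝ) ^ 2 := by rw [Real.sq_sqrt (by norm_num)]; norm_num
  set ref : Fin 12 → E3 := fun i => refPt N (tab i) with href
  set c : Fin 12 → E3 := fun i => u + (1 / 2 : ℝ) • A (ref i) with hc
  have hcd : ∀ i j, dist (c i) (c j) = 1 / 2 * dist (ref i) (ref j) := by
    intro i j
    simp only [hc, dist_eq_norm, add_sub_add_left_eq_sub, ← smul_sub, ← map_sub, norm_smul,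
      LinearIsometry.norm_map]
    norm_num
  have hadj : ∀ i j, dist (c i) (c j) = 1 ↔ sqNormInt (tab i - tab j) = N := by
    intro i j
    rw [hcd, ← dist_refPt_eq_two_iff hN]
    constructor <;> intro h <;> linarith
  have hcu : ∀ i, dist u (c i) = 1 := by
    intro i
    simp only [hc]
    rw [dist_self_add_right, norm_smul, LinearIsometry.norm_map, href]
    dsimp only
    rw [norm_refPt hN (hnorm i)]
    norm_num
  have hcinj : ∀ i j, c i = c j → i = j := by
    intro i j h
    have h1 : A (ref i) = A (ref j) := by
      have h2 : (1 / 2 : ℝ) • A (ref i) = (1 / 2 : ℝ) • A (ref j) := add_left_cancel h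
      exact smul_right_injective E3 (by norm_num : (1 / 2 : ℝ) ≠ 0) h2
    exact htab (refPt_injective hN (A.injective h1))
  refine ⟨?_, fun q hq hd => ?_⟩
  swap
  · obtain ⟨i, rfl⟩ := hsurj q hq hd
    obtain ⟨j, k, hij, hik, hjk⟩ := htri i
    exact ⟨c j, hmem j, c k, hmem k, hcu j, hcu k, (hadj i j).2 hij, (hadj i k).2 hik,
      (hadj j k).2 hjk⟩
  -- the doubled recentred image of the star realizes the pattern
  set x : Fin 12 → E3 := fun i => (2 : ℝ) • (σ (c i) - σ u) with hx
  have hσd : ∀ i, dist (σ (c i)) (σ u) = 1 := fun i => by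
    rw [dist_comm]; exact (hcontact u hu (c i) (hmem i)).2 (hcu i)
  have hxn : ∀ i, ‖x i‖ = 2 := fun i => by
    simp only [hx]
    rw [norm_smul, Real.norm_two, ← dist_eq_norm, hσd, mul_one]
  have hxd : ∀ i j, dist (x i) (x j) = 2 * dist (σ (c i)) (σ (c j)) := fun i j => by
    simp only [hx]
    rw [dist_eq_norm, ← smul_sub, sub_sub_sub_cancel_right, norm_smul, Real.norm_two,
      dist_eq_norm]
  have hreal : IsRealization (fun i j => sqNormInt (tab i - tab j) = N) 0 x := by
    refine ⟨by norm_num, fun i => ?_, fun i j hij => ?_, fun i j hij hn => ?_⟩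
    · rw [real_inner_self_eq_norm_sq, hxn]; norm_num
    · have h1 : dist (σ (c i)) (σ (c j)) = 1 :=
        (hcontact (c i) (hmem i) (c j) (hmem j)).2 ((hadj i j).2 hij)
      rw [inner_eq_of_norm_eq_two (hxn i) (hxn j), hxd, h1]; norm_num
    · have hne : σ (c i) ≠ σ (c j) := fun h =>
        hij (hcinj i j (hbij.injOn (hmem i) (hmem j) h))
      have hn1 : dist (σ (c i)) (σ (c j)) ≠ 1 := fun h =>
        hn ((hadj i j).1 ((hcontact (c i) (hmem i) (c j) (hmem j)).1 h))
      have hge : Real.sqrt 2 * 1 ≤ dist (σ (c i)) (σ (c j)) := by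
        by_contra hlt
        push Not at hlt
        rcases eq_or_dist_eq_of_dist_lt hs one_pos hsq (hbij.mapsTo (hmem i))
          (hbij.mapsTo (hmem j)) hlt with h | h
        · exact hne h
        · exact hn1 h
      rw [inner_eq_of_norm_eq_two (hxn i) (hxn j), hxd]
      have h2 : Real.sqrt 2 ^ 2 = 2 := Real.sq_sqrt (by norm_num)
      rw [mul_one] at hge
      nlinarith [mul_le_mul hge hge (Real.sqrt_nonneg 2) dist_nonneg]
  obtain ⟨L, hL⟩ := rigid hreal
  -- the isometry `z ↦ σ u + L (A⁻¹ (z - u))`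
  have h3 : Module.finrank ℝ E3 = Module.finrank ℝ E3 := rfl
  set A' : E3 ≃ₗᵢ[ℝ] E3 := A.toLinearIsometryEquiv h3 with hA'
  set L' : E3 ≃ₗᵢ[ℝ] E3 := L.toLinearIsometryEquiv h3 with hL'
  refine ⟨((IsometryEquiv.subRight u).trans (A'.symm.trans L').toIsometryEquiv).trans
    (IsometryEquiv.addLeft (σ u)), ?_, ?_⟩
  · simp
  · intro q hq hd
    obtain ⟨i, rfl⟩ := hsurj q hq hd
    have e1 : u + (1 / 2 : ℝ) • A (ref i) - u = A' ((1 / 2 : ℝ) • ref i) := by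
      rw [add_sub_cancel_left, map_smul]; rfl
    rw [IsometryEquiv.trans_apply, IsometryEquiv.trans_apply, IsometryEquiv.subRight_apply,
      IsometryEquiv.addLeft_apply, LinearIsometryEquiv.coe_toIsometryEquiv,
      LinearIsometryEquiv.trans_apply]
    change σ u + L' (A'.symm (u + (1 / 2 : ℝ) • A (ref i) - u)) = σ (c i)
    rw [e1, A'.symm_apply_apply, map_smul]
    change σ u + (1 / 2 : ℝ) • L (ref i) = σ (c i)
    rw [hL]
    simp only [hx]
    rw [smul_smul, show (1 / 2 : ℝ) * 2 = 1 by norm_num, one_smul, add_sub_cancel]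


/-! ## Isometries are determined on a regular tetrahedron -/

/-- Mazur–Ulam: an isometry of `ℝ³` is its linear part about any base point plus the image of
the base point. [folklore] -/
theorem pt_isometryEquiv_apply_eq (g : E3 ≃ᵢ E3) (z p : E3) :
    g z = g.toRealAffineIsometryEquiv.linearIsometryEquiv (z - p) + g p := by
  have h := g.toRealAffineIsometryEquiv.map_vsub z p
  simp only [IsometryEquiv.coeFn_toRealAffineIsometryEquiv, vsub_eq_sub] at h
  rw [h, sub_add_cancel]

/-- Polarization: `⟪a − c, b − c⟫` from the three distances. [folklore] -/
theorem pt_inner_sub_sub_of_dist (a b c : E3) :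
    ⟪a - c, b - c⟫ = (dist a c ^ 2 + dist b c ^ 2 - dist a b ^ 2) / 2 := by
  have : a - b = (a - c) - (b - c) := by abel
  rw [dist_eq_norm a b, this, norm_sub_sq_real, dist_eq_norm, dist_eq_norm]
  ring

/-- **Two isometries of `ℝ³` agreeing on the vertices of a regular unit tetrahedron are equal**
(the three edges at a vertex are linearly independent: Gram matrix `½(1 + δᵢⱼ)`). [folklore] -/
theorem pt_isometryEquiv_ext_of_tetra {g g' : E3 ≃ᵢ E3} {p₀ p₁ p₂ p₃ : E3}
    (h01 : dist p₀ p₁ = 1) (h02 : dist p₀ p₂ = 1) (h03 : dist p₀ p₃ = 1)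
    (h12 : dist p₁ p₂ = 1) (h13 : dist p₁ p₃ = 1) (h23 : dist p₂ p₃ = 1)
    (e0 : g p₀ = g' p₀) (e1 : g p₁ = g' p₁) (e2 : g p₂ = g' p₂) (e3 : g p₃ = g' p₃) :
    g = g' := by
  have h10 : dist p₁ p₀ = 1 := (dist_comm _ _).trans h01
  have h20 : dist p₂ p₀ = 1 := (dist_comm _ _).trans h02
  have h30 : dist p₃ p₀ = 1 := (dist_comm _ _).trans h03
  have h21 : dist p₂ p₁ = 1 := (dist_comm _ _).trans h12
  have h31 : dist p₃ p₁ = 1 := (dist_comm _ _).trans h13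
  have h32 : dist p₃ p₂ = 1 := (dist_comm _ _).trans h23
  have hin : ∀ a b : E3, ⟪(2 : ℝ) • (a - p₀), (2 : ℝ) • (b - p₀)⟫ =
      2 * (dist a p₀ ^ 2 + dist b p₀ ^ 2 - dist a b ^ 2) := by
    intro a b
    rw [real_inner_smul_left, real_inner_smul_right, pt_inner_sub_sub_of_dist]
    ring
  have hdiag : ∀ a : E3, dist a p₀ = 1 → ⟪(2 : ℝ) • (a - p₀), (2 : ℝ) • (a - p₀)⟫ = 4 := by
    intro a ha; rw [hin, ha, dist_self]; norm_num
  have hoff : ∀ a b : E3, dist a p₀ = 1 → dist b p₀ = 1 → dist a b = 1 →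
      ⟪(2 : ℝ) • (a - p₀), (2 : ℝ) • (b - p₀)⟫ = 2 := by
    intro a b ha hb hab; rw [hin, ha, hb, hab]; norm_num
  have hli : LinearIndependent ℝ
      ![(2 : ℝ) • (p₁ - p₀), (2 : ℝ) • (p₂ - p₀), (2 : ℝ) • (p₃ - p₀)] := by
    refine linearIndependent_of_gram_triangle ?_ ?_
    · intro i
      fin_cases i
      · exact hdiag _ h10
      · exact hdiag _ h20
      · exact hdiag _ h30
    · intro i j hij
      fin_cases i <;> fin_cases j <;> first
        | exact absurd rfl hij
        | exact hoff _ _ h10 h20 h12 | exact hoff _ _ h10 h30 h13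
        | exact hoff _ _ h20 h10 h21 | exact hoff _ _ h20 h30 h23
        | exact hoff _ _ h30 h10 h31 | exact hoff _ _ h30 h20 h32
  have hspan := hli.span_eq_top_of_card_eq_finrank (by simp)
  set Lg := g.toRealAffineIsometryEquiv.linearIsometryEquiv with hLg
  set Lg' := g'.toRealAffineIsometryEquiv.linearIsometryEquiv with hLg'
  have hLv : ∀ a, Lg (a - p₀) = g a - g p₀ := fun a => by
    rw [pt_isometryEquiv_apply_eq g a p₀, add_sub_cancel_right]
  have hL'v : ∀ a, Lg' (a - p₀) = g' a - g' p₀ := fun a => by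
    rw [pt_isometryEquiv_apply_eq g' a p₀, add_sub_cancel_right]
  have hagree : ∀ a, g a = g' a → Lg ((2 : ℝ) • (a - p₀)) = Lg' ((2 : ℝ) • (a - p₀)) := by
    intro a ha
    rw [map_smul, map_smul, hLv, hL'v, ha, e0]
  have key : ∀ i, Lg (![(2 : ℝ) • (p₁ - p₀), (2 : ℝ) • (p₂ - p₀), (2 : ℝ) • (p₃ - p₀)] i) =
      Lg' (![(2 : ℝ) • (p₁ - p₀), (2 : ℝ) • (p₂ - p₀), (2 : ℝ) • (p₃ - p₀)] i) := by
    intro i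
    fin_cases i
    · exact hagree _ e1
    · exact hagree _ e2
    · exact hagree _ e3
  have hext : Lg.toLinearEquiv.toLinearMap = Lg'.toLinearEquiv.toLinearMap := by
    refine LinearMap.ext_on_range hspan fun i => ?_
    simpa using key i
  refine IsometryEquiv.ext fun z => ?_
  rw [pt_isometryEquiv_apply_eq g z p₀, pt_isometryEquiv_apply_eq g' z p₀, e0]
  congr 1
  exact LinearMap.congr_fun hext (z - p₀)

/-! ## Rigidity of contact automorphisms -/

/-- Every vertex of the cuboctahedron lies in a contact triangle. [folklore] -/
theorem pt_fcc_triangle : ∀ i : Fin 12, ∃ j k, fccAdj i j ∧ fccAdj i k ∧ fccAdj j k := by decide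

/-- Every vertex of the anticuboctahedron lies in a contact triangle. [folklore] -/
theorem pt_hcp_triangle : ∀ i : Fin 12, ∃ j k, hcpAdj i j ∧ hcpAdj i k ∧ hcpAdj j k := by decide

/-- **Local rigidity at every site of the model** (FCC or HCP star), with the tetrahedra through
the edges of the star. [folklore] -/
theorem pt_local_rigidity_site {s : ℤ → ℤ} {σ : E3 → E3} (hs : IsHaggSeq s)
    (hbij : Set.BijOn σ (barlowStacking 1 (Real.sqrt (2 / 3)) s) (barlowStacking 1 (Real.sqrt (2 / 3)) s))
    (hcontact : ∀ q ∈ barlowStacking 1 (Real.sqrt (2 / 3)) s, ∀ q' ∈ barlowStacking 1 (Real.sqrt (2 / 3)) s,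
      (dist (σ q) (σ q') = 1 ↔ dist q q' = 1))
    {u : E3} (hu : u ∈ barlowStacking 1 (Real.sqrt (2 / 3)) s) :
    (∃ g : E3 ≃ᵢ E3, g u = σ u ∧
      ∀ q ∈ barlowStacking 1 (Real.sqrt (2 / 3)) s, dist u q = 1 → g q = σ q) ∧
    (∀ q ∈ barlowStacking 1 (Real.sqrt (2 / 3)) s, dist u q = 1 →
      ∃ r ∈ barlowStacking 1 (Real.sqrt (2 / 3)) s, ∃ r' ∈ barlowStacking 1 (Real.sqrt (2 / 3)) s,
        dist u r = 1 ∧ dist u r' = 1 ∧ dist q r = 1 ∧ dist q r' = 1 ∧ dist r r' = 1) := by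
  obtain ⟨A, hA | hA⟩ := pt_exists_frame hs hu
  · exact pt_local_rigidity hs hbij hcontact two_ne_zero fccTab_injective (by decide)
      (fun hx => fcc_rigid hx) pt_fcc_triangle hu A hA.1 hA.2
  · exact pt_local_rigidity hs hbij hcontact (by norm_num) hcpTab_injective (by decide)
      (fun hx => hcp_rigid hx) pt_hcp_triangle hu A hA.1 hA.2

/-- **A contact automorphism of an ideal Barlow stacking is the restriction of an isometry of
`ℝ³`** (local rigidity of the stars, propagated along the connected contact graph). [folklore] -/
theorem contactAut_eq_isometry : ∀ (s : ℤ → ℤ) (σ : EuclideanSpace ℝ (Fin 3) → EuclideanSpace ℝ (Fin 3)), IsHaggSeq s → Set.BijOn σ (barlowStacking 1 (Real.sqrt (2 / 3)) s) (barlowStacking 1 (Real.sqrt (2 / 3)) s) → (∀ q ∈ barlowStacking 1 (Real.sqrt (2 / 3)) s, ∀ q' ∈ barlowStacking 1 (Real.sqrt (2 / 3)) s, (dist (σ q) (σ q') = 1 ↔ dist q q' = 1)) → ∃ g : EuclideanSpace ℝ (Fin 3) ≃ᵢ EuclideanSpace ℝ (Fin 3), ∀ q ∈ barlowStacking 1 (Real.sqrt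 (2 / 3)) s, g q = σ q := by
  intro s σ hs hbij hcontact
  have hsq : Real.sqrt (2 / 3) ^ 2 = 2 / 3 * (1 : ℝ) ^ 2 := by rw [Real.sq_sqrt (by norm_num)]; norm_num
  set B := barlowStacking 1 (Real.sqrt (2 / 3)) s with hB
  obtain ⟨⟨g, hg0, hg1⟩, -⟩ := pt_local_rigidity_site hs hbij hcontact (barlowPos_mem 0 0 0)
  refine ⟨g, ?_⟩
  -- propagation of agreement across an edge
  have step : ∀ u ∈ B, ∀ u' ∈ B, dist u u' = 1 →
      (g u = σ u ∧ ∀ q ∈ B, dist u q = 1 → g q = σ q) →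
      (g u' = σ u' ∧ ∀ q ∈ B, dist u' q = 1 → g q = σ q) := by
    rintro u hu u' hu' hd ⟨hgu, hgq⟩
    have hd' : dist u' u = 1 := by rw [dist_comm]; exact hd
    obtain ⟨⟨g', hg'u, hg'q⟩, htet⟩ := pt_local_rigidity_site hs hbij hcontact hu'
    obtain ⟨r, hr, r', hr', hur, hur', h1, h2, h3⟩ := htet u hu hd'
    have heq : g = g' :=
      pt_isometryEquiv_ext_of_tetra hd' hur hur' h1 h2 h3
        (by rw [hgq u' hu' hd, hg'u]) (by rw [hgu, hg'q u hu hd'])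
        (by rw [hgq r hr h1, hg'q r hr hur]) (by rw [hgq r' hr' h2, hg'q r' hr' hur'])
    rw [heq]
    exact ⟨hg'u, hg'q⟩
  -- the three generating contacts
  have hv : ∀ k i j : ℤ, dist (barlowPos 1 (Real.sqrt (2 / 3)) s (k + 1) i j)
      (barlowPos 1 (Real.sqrt (2 / 3)) s k i j) = 1 := by
    intro k i j
    rw [dist_barlowPos_succ_eq 1 (Real.sqrt (2 / 3)) hs, Real.sq_sqrt (by norm_num)]
    norm_num
  have hi : ∀ k i j : ℤ, dist (barlowPos 1 (Real.sqrt (2 / 3)) s k (i + 1) j)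
      (barlowPos 1 (Real.sqrt (2 / 3)) s k i j) = 1 := by
    intro k i j
    rw [dist_barlowPos_eq_iff_form one_pos hsq]
    ring
  have hj : ∀ k i j : ℤ, dist (barlowPos 1 (Real.sqrt (2 / 3)) s k i (j + 1))
      (barlowPos 1 (Real.sqrt (2 / 3)) s k i j) = 1 := by
    intro k i j
    rw [dist_barlowPos_eq_iff_form one_pos hsq]
    ring
  have hk0 : ∀ k : ℤ, g (barlowPos 1 (Real.sqrt (2 / 3)) s k 0 0) = σ (barlowPos 1 (Real.sqrt (2 / 3)) s k 0 0) ∧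
      ∀ q ∈ B, dist (barlowPos 1 (Real.sqrt (2 / 3)) s k 0 0) q = 1 → g q = σ q := by
    intro k
    induction k with
    | zero => exact ⟨hg0, hg1⟩
    | succ n ih =>
      refine step _ (barlowPos_mem _ _ _) _ (barlowPos_mem _ _ _) ?_ ih
      rw [dist_comm]; exact hv _ 0 0
    | pred n ih =>
      refine step _ (barlowPos_mem _ _ _) _ (barlowPos_mem _ _ _) ?_ ih
      have := hv (-(n : ℤ) - 1) 0 0
      rwa [sub_add_cancel] at this
  have hki : ∀ k i : ℤ, g (barlowPos 1 (Real.sqrt (2 / 3)) s k i 0) = σ (barlowPos 1 (Real.sqrt (2 / 3)) s k i 0) ∧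
      ∀ q ∈ B, dist (barlowPos 1 (Real.sqrt (2 / 3)) s k i 0) q = 1 → g q = σ q := by
    intro k i
    induction i with
    | zero => exact hk0 k
    | succ n ih =>
      refine step _ (barlowPos_mem _ _ _) _ (barlowPos_mem _ _ _) ?_ ih
      rw [dist_comm]; exact hi k _ 0
    | pred n ih =>
      refine step _ (barlowPos_mem _ _ _) _ (barlowPos_mem _ _ _) ?_ ih
      have := hi k (-(n : ℤ) - 1) 0
      rwa [sub_add_cancel] at this
  have hkij : ∀ k i j : ℤ, g (barlowPos 1 (Real.sqrt (2 / 3)) s k i j) = σ (barlowPos 1 (Real.sqrt (2 / 3)) s k i j) ∧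
      ∀ q ∈ B, dist (barlowPos 1 (Real.sqrt (2 / 3)) s k i j) q = 1 → g q = σ q := by
    intro k i j
    induction j with
    | zero => exact hki k i
    | succ n ih =>
      refine step _ (barlowPos_mem _ _ _) _ (barlowPos_mem _ _ _) ?_ ih
      rw [dist_comm]; exact hj k i _
    | pred n ih =>
      refine step _ (barlowPos_mem _ _ _) _ (barlowPos_mem _ _ _) ?_ ih
      have := hj k i (-(n : ℤ) - 1)
      rwa [sub_add_cancel] at this
  rintro q ⟨k, i, j, rfl⟩
  exact (hkij k i j).1

end Summit.AtomisticToContinuum.Crystallization.Theorems.PalmUnimodularRigidityShellsToBarlowChart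

end
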